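import Summits.RiemannHypothesis.RiemannHypothesis.Theorems.HandoffEdgeEven
import HarnessLib

/-!
# HANDOFF, edge block: the ODD sector — exact signed identity, the gap-free codimension-two class, and the witness criterion (rh-explicit, track «HANDOFF», seat prove-2 gen2, ATTEMPT-7)

HONEST FRAMING. Nothing here bears on RH. `EdgeNonnegOdd q q′ η` (`HandoffEdgeEven.lean`) is the odd half of the edge block of the
Schur route, a NECESSARY piece of `H(q)`. ATTEMPT-7 shows (DERIVED numerics) that it is equivalent, up to a factor `< 2` in one constant,
to a Cramér-order bound on the prime gap after `q`. This file proves the exact skeleton of that claim: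

* `weilQuadratic_sub_comp_neg` — for a lobe `f` the odd two-lobe function `f − f(−·)` has energy
  `Q(f − f(−·)) = 2·Q(f) − 2·W(f ⋆ (f(−·))~)` (PROVED), and the polar part of the cross energy is `|f̂(0)|² + |f̂(1)|²`
  (`weilPolarTerm_cross_reflect`), now entering with a MINUS sign: the uncompensated polar mass of the prime-free gap.
* `re_weilQuadratic_sub_comp_neg_le` / `_ge` — two-sided bounds
  `|Re Q(f − f(−·)) − 2·Re Q(f) + 2(|f̂(0)|² + |f̂(1)|²)| ≤ 2·X_ev(b)·‖f‖₂²` with the EVEN cross constant `X_ev = handoffCrossConstEven`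
  (prime powers in the gap + archimedean tail only) (PROVED).
* `re_weilQuadratic_nonneg_of_odd_mellin_zero` — on the codimension-two class of odd edge-layer functions whose right lobe has
  `f̂(0) = f̂(1) = 0` the odd block is GAP-FREE: it follows from the even inequality (EVEN-q) of ATTEMPT-6 (PROVED). So the whole
  prime-gap proviso of the edge block is carried by the rank-two polar form `|f̂(0)|² + |f̂(1)|²` of the odd lobe (ATTEMPT-4 R3, ATTEMPT-7 §6 R1).
* `not_edgeNonnegOdd_of_witness` — the WITNESS CRITERION: one lobe `f ⊆ [(log q)/2, b]` with
  `Re Q(f) + X_ev(b)·‖f‖₂² < |f̂(0)|² + |f̂(1)|²` refutes `EdgeNonnegOdd q q′ η` (PROVED). ATTEMPT-7 §2–§3 evaluates the left side for an explicit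
  bump (`≈ (log(1/δ) − 1.4)‖f‖²`) against the right side (`≈ 0.92·√q·δ·‖f‖²`, `δ = ½log(q′/q)`): the criterion fires exactly for gaps
  `q′ − q ≳ (0.56…0.93)·√q·log q` — the Cramér scale (numbers DERIVED there, not here).
-/

set_option linter.dupNamespace false

noncomputable section

open Complex Filter Set MeasureTheory Literature.NumberTheory.LFunctions
open scoped Real Topology ComplexConjugate ContDiff

namespace Summit.RiemannHypothesis.RiemannHypothesis.Theorems.Handoff

variable {f h : ℝ → ℂ} {q q' : ℕ}

/-! ## §1 The odd two-lobe energy: exact identity -/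

/-- **Energy of an antisymmetrised lobe.** For a Weil test function `f`:
`Q(f − f(−·)) = 2·Q(f) − 2·W(f ⋆ (f(−·))~)` (polarisation `weilQuadratic_add`, `Q(−g) = Q(g) = Q(f)` for `g = f(−·)`, and the two
cross energies coincide, `weilFunctional_cross_comp_neg_eq`). [this track, ATTEMPT-7 §2 (7.1); cite: Bombieri2000Weil, §3 (hermitian form)] -/
theorem weilQuadratic_sub_comp_neg (hf : IsWeilTest f) :
    weilQuadratic (fun x ↦ f x - f (-x)) =
      2 * weilQuadratic f - 2 * weilFunctional (weilConv f (weilReflect fun x ↦ f (-x))) := by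
  set g : ℝ → ℂ := fun x ↦ f (-x) with hg_def
  set hm : ℝ → ℂ := fun x ↦ (-1 : ℂ) * g x with hm_def
  have hg : IsWeilTest g := hf.comp_neg
  have hhm : IsWeilTest hm := hg.const_mul (-1)
  have hsum : (fun x ↦ f x - f (-x)) = f + hm := by
    funext x
    simp only [hm_def, hg_def, Pi.add_apply]
    ring
  rw [hsum, weilQuadratic_add hf hhm]
  have hQ : weilQuadratic hm = weilQuadratic f := by
    rw [hm_def, weilQuadratic_const_mul, hg_def, weilQuadratic_comp_neg]
    simp [Complex.normSq_neg, Complex.normSq_one]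
  have h1 : weilFunctional (weilConv f (weilReflect hm)) = -weilFunctional (weilConv f (weilReflect g)) := by
    rw [hm_def, weilReflect_const_mul, weilConv_const_mul_right, weilFunctional_const_mul]
    simp
  have h2 : weilFunctional (weilConv hm (weilReflect f)) = -weilFunctional (weilConv f (weilReflect g)) := by
    rw [hm_def, weilConv_const_mul_left, weilFunctional_const_mul, hg_def, weilFunctional_cross_comp_neg_eq]
    simp
  rw [hQ, h1, h2]
  ring

/-- The antisymmetrisation of a Weil test function is a Weil test function. [folklore] -/
theorem isWeilTest_sub_comp_neg (hf : IsWeilTest f) : IsWeilTest (fun x ↦ f x - f (-x)) := by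
  have h := hf.add (hf.comp_neg.const_mul (-1))
  convert h using 1
  funext x
  simp only [Pi.add_apply]
  ring

/-! ## §2 Two-sided bounds with the even cross constant -/

/-- **Upper bound (the witness side).** For a lobe `f ⊆ [c′, b]` (`0 < c′ ≤ b`):
`Re Q(f − f(−·)) ≤ 2·Re Q(f) − 2(|f̂(0)|² + |f̂(1)|²) + 2·(4(b − c′)M(c′) + 2·gapAtomSum(c′, b))·‖f‖₂²`
(the polar part of the cross energy is exactly `|f̂(0)|² + |f̂(1)|²`; prime and archimedean parts as in `re_weilFunctional_cross_reflect_ge`).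
[this track, ATTEMPT-7 §2; cite: Bombieri2000, Thm 2 (prime and archimedean terms)] -/
theorem re_weilQuadratic_sub_comp_neg_le (hf : IsWeilTest f) {c' b : ℝ} (hc' : 0 < c') (hcb : c' ≤ b)
    (hfs : tsupport f ⊆ Icc c' b) :
    (weilQuadratic (fun x ↦ f x - f (-x))).re ≤
      2 * (weilQuadratic f).re - 2 * (Complex.normSq (weilMellin f 0) + Complex.normSq (weilMellin f 1)) +
        2 * (4 * archGapBound c' * (b - c') + 2 * gapAtomSum c' b) * ∫ u : ℝ, ‖f u‖ ^ 2 := by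
  set g : ℝ → ℂ := fun x ↦ f (-x) with hg_def
  have hg : IsWeilTest g := hf.comp_neg
  have hgs : tsupport g ⊆ Icc (-b) (-c') := by
    intro x hx
    have := tsupport_comp_subset_preimage_of_continuous f continuous_neg (by simpa [Function.comp_def] using hx)
    have hm := hfs this
    simp only [Set.mem_Icc] at hm
    exact ⟨by linarith [hm.2], by linarith [hm.1]⟩
  set N := ∫ u : ℝ, ‖f u‖ ^ 2 with hN_def
  have hN : 0 ≤ N := integral_nonneg fun _ ↦ by positivity
  have hNg : ∫ u : ℝ, ‖g u‖ ^ 2 = N := integral_neg_eq_self (fun u : ℝ ↦ ‖f u‖ ^ 2) volume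
  set k := weilConv f (weilReflect g) with hk_def
  have hP : (weilPolarTerm k).re = Complex.normSq (weilMellin f 0) + Complex.normSq (weilMellin f 1) := by
    rw [hk_def, hg_def, weilPolarTerm_cross_reflect hf, Complex.ofReal_re]
  have hPr : ‖weilPrimeTerm k‖ ≤ 2 * gapAtomSum c' b * ((N + N) / 2) := by
    have h' : ‖weilPrimeTerm k‖ ≤
        2 * gapAtomSum c' b * (((∫ u : ℝ, ‖f u‖ ^ 2) + ∫ u : ℝ, ‖g u‖ ^ 2) / 2) :=
      norm_weilPrimeTerm_le_of_support (c' := c') (b := b) hc'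
        (fun y hy ↦ weilConv_weilReflect_eq_zero_of_lt hfs hgs (by linarith [(abs_lt.1 hy).2]))
        (fun y hy ↦ by
          rcases lt_or_ge y 0 with h0 | h0
          · exact weilConv_weilReflect_eq_zero_of_lt hfs hgs (by rw [abs_of_neg h0] at hy; linarith)
          · exact weilConv_weilReflect_eq_zero_of_gt hfs hgs (by rw [abs_of_nonneg h0] at hy; linarith))
        (norm_weilConv_weilReflect_le_half_add hf hg)
    rwa [hNg] at h'
  have hA : ‖weilArchTerm k‖ ≤ 2 * (b - c') * archGapBound c' * (N + N) := by
    have := norm_weilArchTerm_cross_le hf hg hc' hcb hfs hgs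
    rwa [hNg] at this
  have hre_pr : (weilPrimeTerm k).re ≤ ‖weilPrimeTerm k‖ := Complex.re_le_norm _
  have hre_ar : -‖weilArchTerm k‖ ≤ (weilArchTerm k).re := (abs_le.1 (Complex.abs_re_le_norm _)).1
  have hW : (weilFunctional k).re = (weilPolarTerm k).re - (weilPrimeTerm k).re + (weilArchTerm k).re := by
    simp [weilFunctional]
  rw [weilQuadratic_sub_comp_neg hf]
  have e : (2 * weilQuadratic f - 2 * weilFunctional k).re = 2 * (weilQuadratic f).re - 2 * (weilFunctional k).re := by
    simp [Complex.sub_re, Complex.mul_re]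
  rw [e, hW, hP]
  have hM0 : 0 ≤ archGapBound c' := (archGapBound_pos hc').le
  have hG0 : 0 ≤ gapAtomSum c' b := gapAtomSum_nonneg c' b
  nlinarith [hPr, hA, hre_pr, hre_ar, hM0, hG0, hN]

/-- **Lower bound (the companion).** Same hypotheses:
`2·Re Q(f) − 2(|f̂(0)|² + |f̂(1)|²) − 2·(4(b − c′)M(c′) + 2·gapAtomSum(c′, b))·‖f‖₂² ≤ Re Q(f − f(−·))`. [this track, ATTEMPT-7 §2] -/
theorem re_weilQuadratic_sub_comp_neg_ge (hf : IsWeilTest f) {c' b : ℝ} (hc' : 0 < c') (hcb : c' ≤ b)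
    (hfs : tsupport f ⊆ Icc c' b) :
    2 * (weilQuadratic f).re - 2 * (Complex.normSq (weilMellin f 0) + Complex.normSq (weilMellin f 1)) -
        2 * (4 * archGapBound c' * (b - c') + 2 * gapAtomSum c' b) * ∫ u : ℝ, ‖f u‖ ^ 2 ≤
      (weilQuadratic (fun x ↦ f x - f (-x))).re := by
  set g : ℝ → ℂ := fun x ↦ f (-x) with hg_def
  have hg : IsWeilTest g := hf.comp_neg
  have hgs : tsupport g ⊆ Icc (-b) (-c') := by
    intro x hx
    have := tsupport_comp_subset_preimage_of_continuous f continuous_neg (by simpa [Function.comp_def] using hx)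
    have hm := hfs this
    simp only [Set.mem_Icc] at hm
    exact ⟨by linarith [hm.2], by linarith [hm.1]⟩
  set N := ∫ u : ℝ, ‖f u‖ ^ 2 with hN_def
  have hN : 0 ≤ N := integral_nonneg fun _ ↦ by positivity
  have hNg : ∫ u : ℝ, ‖g u‖ ^ 2 = N := integral_neg_eq_self (fun u : ℝ ↦ ‖f u‖ ^ 2) volume
  set k := weilConv f (weilReflect g) with hk_def
  have hP : (weilPolarTerm k).re = Complex.normSq (weilMellin f 0) + Complex.normSq (weilMellin f 1) := by
    rw [hk_def, hg_def, weilPolarTerm_cross_reflect hf, Complex.ofReal_re]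
  have hPr : ‖weilPrimeTerm k‖ ≤ 2 * gapAtomSum c' b * ((N + N) / 2) := by
    have h' : ‖weilPrimeTerm k‖ ≤
        2 * gapAtomSum c' b * (((∫ u : ℝ, ‖f u‖ ^ 2) + ∫ u : ℝ, ‖g u‖ ^ 2) / 2) :=
      norm_weilPrimeTerm_le_of_support (c' := c') (b := b) hc'
        (fun y hy ↦ weilConv_weilReflect_eq_zero_of_lt hfs hgs (by linarith [(abs_lt.1 hy).2]))
        (fun y hy ↦ by
          rcases lt_or_ge y 0 with h0 | h0
          · exact weilConv_weilReflect_eq_zero_of_lt hfs hgs (by rw [abs_of_neg h0] at hy; linarith)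
          · exact weilConv_weilReflect_eq_zero_of_gt hfs hgs (by rw [abs_of_nonneg h0] at hy; linarith))
        (norm_weilConv_weilReflect_le_half_add hf hg)
    rwa [hNg] at h'
  have hA : ‖weilArchTerm k‖ ≤ 2 * (b - c') * archGapBound c' * (N + N) := by
    have := norm_weilArchTerm_cross_le hf hg hc' hcb hfs hgs
    rwa [hNg] at this
  have hre_pr : -‖weilPrimeTerm k‖ ≤ (weilPrimeTerm k).re := (abs_le.1 (Complex.abs_re_le_norm _)).1
  have hre_ar : (weilArchTerm k).re ≤ ‖weilArchTerm k‖ := Complex.re_le_norm _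
  have hW : (weilFunctional k).re = (weilPolarTerm k).re - (weilPrimeTerm k).re + (weilArchTerm k).re := by
    simp [weilFunctional]
  rw [weilQuadratic_sub_comp_neg hf]
  have e : (2 * weilQuadratic f - 2 * weilFunctional k).re = 2 * (weilQuadratic f).re - 2 * (weilFunctional k).re := by
    simp [Complex.sub_re, Complex.mul_re]
  rw [e, hW, hP]
  have hM0 : 0 ≤ archGapBound c' := (archGapBound_pos hc').le
  have hG0 : 0 ≤ gapAtomSum c' b := gapAtomSum_nonneg c' b
  nlinarith [hPr, hA, hre_pr, hre_ar, hM0, hG0, hN]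

/-! ## §3 The gap-free codimension-two class -/

/-- For an ODD `h` the left lobe is MINUS the mirror image of the right lobe: `h₋ = −h₊(−·)`. [this track, ATTEMPT-7 §2] -/
theorem edgeLobeLeft_eq_neg_comp_neg_of_odd {c : ℝ} (hc : c ≠ 0) (hodd : ∀ x, h (-x) = -h x) :
    edgeLobeLeft c h = fun x ↦ -edgeLobeRight c h (-x) := by
  funext x
  have hx : h x = -h (-x) := by rw [hodd x]; ring
  simp only [edgeLobeLeft, edgeLobeRight, edgeStep_neg hc]
  rw [hx]
  push_cast
  ring

/-- **The odd block is gap-free on the codimension-two class `f̂₊(0) = f̂₊(1) = 0`.** For consecutive primes `q < q′`, an overlap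
`0 < η < min((log q)/2, (log 2)/2)` and a `b` in the window where the EVEN inequality `X_ev(b) ≤ lobeCoercivity(b − c′, K)` holds
(ATTEMPT-6 (EVEN-q)): every ODD edge-layer function `h` whose right lobe `h₊ = edgeLobeRight c′ h` has `ĥ₊(0) = ĥ₊(1) = 0` satisfies
`Re Q(h) ≥ 0`. So the prime-gap proviso of the edge block is carried entirely by the rank-two polar form `|ĥ₊(0)|² + |ĥ₊(1)|²`.
[this track, ATTEMPT-4 §6 R3, ATTEMPT-7 §6 R1] -/
theorem re_weilQuadratic_nonneg_of_odd_mellin_zero (hcons : ConsecutivePrimes q q') {η : ℝ} (hη : 0 < η)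
    (hη' : η < Real.log q / 2) (hη2 : η < Real.log 2 / 2) {b : ℝ} (hb : b ∈ Icc (Real.log q / 2) (Real.log q' / 2))
    {K : ℝ} (hK : 2 ≤ K) (hXK : handoffCrossConstEven q η b ≤ lobeCoercivity (b - (Real.log q / 2 - η)) K)
    (hh : IsEdgeLayer q η b h) (hodd : ∀ x, h (-x) = -h x)
    (h0 : weilMellin (edgeLobeRight (Real.log q / 2 - η) h) 0 = 0)
    (h1 : weilMellin (edgeLobeRight (Real.log q / 2 - η) h) 1 = 0) :
    0 ≤ (weilQuadratic h).re := by
  set c : ℝ := Real.log q / 2 - η with hc_def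
  have hc : 0 < c := by rw [hc_def]; linarith
  have hq0 : (0 : ℝ) < q := by exact_mod_cast hcons.1.pos
  have hwin : Real.log q' / 2 ≤ Real.log q / 2 + Real.log 2 / 2 := by
    have h2q : (q' : ℝ) ≤ 2 * q := by exact_mod_cast hcons.le_two_mul
    have hq'0 : (0 : ℝ) < q' := by exact_mod_cast hcons.2.1.pos
    have := Real.log_le_log hq'0 h2q
    rw [Real.log_mul (by norm_num) hq0.ne'] at this
    linarith
  have hcb : c < b := by rw [hc_def]; linarith [hb.1]
  have hlen : b - c ≤ Real.log 2 := by rw [hc_def]; linarith [hb.2]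
  set hp := edgeLobeRight c h with hp_def
  have hhp : IsWeilTest hp := isWeilTest_edgeLobeRight c hh.1
  have hcore : ∀ x : ℝ, |x| < c → h x = 0 := fun x hx ↦ hh.2.2 x (by rw [hc_def] at hx; exact hx)
  have hps : tsupport hp ⊆ Icc c b := tsupport_edgeLobeRight_subset hc hh.2.1 hcore
  have hleft : edgeLobeLeft c h = fun x ↦ -hp (-x) := edgeLobeLeft_eq_neg_comp_neg_of_odd hc.ne' hodd
  have hsum : h = fun x ↦ hp x - hp (-x) := by
    have e := (edgeLobeRight_add_edgeLobeLeft c h).symm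
    rw [hleft] at e
    rw [e]
    funext x
    simp only [Pi.add_apply]
    ring
  rw [hsum]
  have hlow := re_weilQuadratic_sub_comp_neg_ge hhp hc hcb.le hps
  have hS := re_weilQuadratic_lobe_ge_param hhp hcb hlen hps hK
  rw [h0, h1] at hlow
  have hXdef : handoffCrossConstEven q η b = 4 * archGapBound c * (b - c) + 2 * gapAtomSum c b := by
    rw [handoffCrossConstEven, hc_def]
  rw [hXdef] at hXK
  have hnp : 0 ≤ ∫ t : ℝ, ‖hp t‖ ^ 2 := integral_nonneg fun _ ↦ by positivity
  have h2 := mul_le_mul_of_nonneg_right hXK hnp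
  simp only [map_zero, add_zero] at hlow
  nlinarith [hlow, hS, h2, hnp]

/-! ## §4 The witness criterion -/

/-- **WITNESS CRITERION for the odd block.** For `0 < η < (log q)/2`, a `b` in the window of `q < q′`, and ONE Weil test function `f`
supported in `[(log q)/2, b]` with `Re Q(f) + X_ev(b)·‖f‖₂² < |f̂(0)|² + |f̂(1)|²`: the odd function `f − f(−·)` is an odd edge-layer
function of negative energy, so `¬ EdgeNonnegOdd q q′ η`. (ATTEMPT-7 §3: for a near-flat smooth bump filling the window this fires iff
the gap `q′ − q` exceeds `g*(q) ≈ (0.56…0.93)·√q·log q` — the Cramér scale; that evaluation is DERIVED numerics, not part of this theorem.)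
[this track, ATTEMPT-7 §2–§3] -/
theorem not_edgeNonnegOdd_of_witness {η : ℝ} (hη : 0 < η) (hη' : η < Real.log q / 2) {b : ℝ}
    (hb : b ∈ Icc (Real.log q / 2) (Real.log q' / 2)) (hf : IsWeilTest f)
    (hfs : tsupport f ⊆ Icc (Real.log q / 2) b)
    (hneg : (weilQuadratic f).re + handoffCrossConstEven q η b * ∫ u : ℝ, ‖f u‖ ^ 2 <
      Complex.normSq (weilMellin f 0) + Complex.normSq (weilMellin f 1)) :
    ¬ EdgeNonnegOdd q q' η := by
  intro hE
  set c : ℝ := Real.log q / 2 - η with hc_def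
  have hc : 0 < c := by rw [hc_def]; linarith
  have hcb : c ≤ b := by rw [hc_def]; linarith [hb.1]
  have hfs' : tsupport f ⊆ Icc c b := hfs.trans (Icc_subset_Icc (by rw [hc_def]; linarith) le_rfl)
  -- the odd function f − f(−·) is an edge-layer function
  set hfun : ℝ → ℂ := fun x ↦ f x - f (-x) with hfun_def
  have hft : IsWeilTest hfun := isWeilTest_sub_comp_neg hf
  have hfb : tsupport f ⊆ Icc (-b) b := hfs.trans (Icc_subset_Icc (by linarith [hb.1, hη, hη']) le_rfl)
  have hsupp : tsupport hfun ⊆ Icc (-b) b :=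
    tsupport_subset_Icc_of_symm hfb (fun s hs1 hs2 ↦ by simp [hfun_def, hs1, hs2])
  have hzero : ∀ x : ℝ, x < Real.log q / 2 → f x = 0 := by
    intro x hx
    by_contra hne
    have := hfs (subset_tsupport _ (Function.mem_support.2 hne))
    linarith [this.1]
  have hcore : ∀ x : ℝ, |x| < Real.log q / 2 - η → hfun x = 0 := by
    intro x hx
    have hx1 : x < Real.log q / 2 := by linarith [(abs_lt.1 hx).2]
    have hx2 : -x < Real.log q / 2 := by linarith [(abs_lt.1 hx).1]
    simp [hfun_def, hzero x hx1, hzero (-x) hx2]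
  have hedge : IsEdgeLayer q η b hfun := ⟨hft, hsupp, hcore⟩
  have hodd : ∀ x, hfun (-x) = -hfun x := fun x ↦ by simp only [hfun_def, neg_neg]; ring
  have hpos := hE b hb hfun hedge hodd
  have hup := re_weilQuadratic_sub_comp_neg_le hf hc hcb hfs'
  have hXdef : handoffCrossConstEven q η b = 4 * archGapBound c * (b - c) + 2 * gapAtomSum c b := by
    rw [handoffCrossConstEven, hc_def]
  rw [hXdef] at hneg
  linarith

end Summit.RiemannHypothesis.RiemannHypothesis.Theorems.Handoff
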